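import Mathlib
import HarnessLib
import Literature.Analysis.FluidPDE.SuitableWeak
import Literature.Analysis.FluidPDE.SelfSimilar
import Literature.Analysis.FluidPDE.LocalTypeI
import Literature.Analysis.FluidPDE.SpaceTimeRescaling
import Literature.Analysis.FluidPDE.LocalTypeIScaling
import Literature.Analysis.FluidPDE.LocalTypeICongr
import Literature.Analysis.FluidPDE.LocalTypeILscGradient
import Literature.Analysis.FluidPDE.LocalTypeISlabProfile
import Literature.Analysis.FluidPDE.SlabTypeICompactness
import Summits.NavierStokesRegularity.NavierStokesRegularity.Theorems.RellichScarApexLocalisationSpherePersistence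
import Summits.NavierStokesRegularity.NavierStokesRegularity.Theorems.RellichScarApexLocalisationMovingCentrePersistence
import Summits.NavierStokesRegularity.NavierStokesRegularity.Theorems.RellichScarApexLocalisationParentChild
import Summits.NavierStokesRegularity.NavierStokesRegularity.Theorems.RellichScarApexLocalisationReductionV3

/-!
# Tight profiles are apex (line dissipation-quantum-tolerance, crux ApexLocalisation,
# stub `stub_tightIsApex`)

Let `(u,p,G)` be a continuous rate-Type-I suitable weak profile on the backward slab
`𝕊 = (-∞,0) × ℝ³` with `𝐈 ≤ I < ⊤`, singular at the space–time origin, and DISSIPATION-TIGHT: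
`sup_{r>0} E(Q((0,0),r)) < (9/4) e`, where `e > 0` is a band quantum at every final-slice singular
point of every continuous class-`(C,4I)` profile (`e ρ ≤ ∫_{Q((−ρ²/4,b),ρ/2)} |∇v|²`).  Then `u` is
apex: `HasTypeIDecay C' u` for some `C'` (`stub_tightIsApex`, fed the accounting stub S4(b)).

Proof.  By `orbitDichotomy` a non-apex profile has shell-centred images
`w_k = λ_k u(λ_k² ·, x_k + λ_k ·)` (`λ_k ≤ ‖x_k‖ ≤ 2λ_k`) converging in `L³_loc` to an
origin-singular continuous class-`(C,4I)` profile `v`.  Along a subsequence the old origins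
`y_k = -x_k/λ_k` converge to some `e₀`, `1 ≤ ‖e₀‖ ≤ 2`, and `v` is singular at `(0,e₀)` too
(`parentSingular_of_imageLimit_of_tendsto`, via `stub_movingCentrePersistence`).  The dissipation of
`w_k` about `(0,y_k)` is the dissipation of `u` about its origin (`cknE_nsZoom`), so it is `≤ T :=
sup_r E(u; Q((0,0),r))`; lower semicontinuity of `E` under the engine's convergence
(`cknE_le_of_tendsto_eLpNorm`) at the moving centre `y_k → e₀` gives `E(v; Q((0,e₀),r)) ≤ T` for
every `r`.  Translating `e₀` to the origin, `v(·, e₀ + ·)` is a continuous class-`(C,4I)` profile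
singular at `0` and at `-e₀`, with quanta at both points, so the accounting S4(b) forces
`E(Q((0,0),2‖e₀‖)) ≥ (9/4) e > T` — a contradiction.

References: D. Albritton, T. Barker, J. Math. Fluid Mech. 21 (2019) = arXiv:1811.00502, Lemma 2.2,
Prop. 2.3, §3 [AlbrittonBarker2019]; L. Caffarelli, R. Kohn, L. Nirenberg, CPAM 35 (1982), §2 (the
quantity `E`) [CaffarelliKohnNirenberg1982].
-/

set_option linter.dupNamespace false

namespace Summit.NavierStokesRegularity.NavierStokesRegularity.Theorems.RellichScarApexLocalisation

open MeasureTheory Set Function Metric Filter Topology TopologicalSpace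
open scoped ENNReal NNReal
open Literature.Analysis Literature.Analysis.FluidPDE
open Summit.NavierStokesRegularity.NavierStokesRegularity.Theorems.ApexLocalisation.Negative.Translate

local notation "E³" => EuclideanSpace ℝ (Fin 3)

/-! ### The old origin of a shell-centred image -/

/-- The image centre `x_k` and scale `λ_k` send the point `y = -λ⁻¹ x` (the old origin in image
coordinates) to the space–time origin: `Φ(0, y) = (0, 0)`. -/
theorem stAffine_oldOrigin {lam : ℝ} (hlam : 0 < lam) (x : E³) :
    stAffine (lam ^ 2) lam 0 x ((0 : ℝ), -(lam⁻¹ • x)) = (0 : ℝ × E³) := by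
  rw [stAffine_apply]
  ext1
  · simp
  · show x + lam • (-(lam⁻¹ • x)) = 0
    rw [smul_neg, smul_smul, mul_inv_cancel₀ hlam.ne', one_smul, add_neg_cancel]

/-- **The dissipation of an image about its old origin is the dissipation of the parent about the
origin**: `E(G_k; Q((0,y_k), r)) = E(G; Q((0,0), λ_k r))` for the image gradient
`G_k = λ_k² G(λ_k² ·, x_k + λ_k ·)` and `y_k = -λ_k⁻¹ x_k` (`cknE_nsZoom`). -/
theorem cknE_image_oldOrigin {lam : ℝ} (hlam : 0 < lam) (x : E³) {r : ℝ} (hr : 0 < r)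
    (G : ℝ → E³ → E³ →L[ℝ] E³) :
    cknE r ((0 : ℝ), -(lam⁻¹ • x)) (lam ^ 2 • stPull (lam ^ 2) lam 0 x G) =
      cknE (lam * r) (0 : ℝ × E³) G := by
  rw [cknE_nsZoom hlam hr 0 x _ G, stAffine_oldOrigin hlam x]

/-! ### Parent–child with a prescribed limit position -/

/-- **Parent–child pair at a prescribed limit position.** If `(u,p,G)` is a continuous class
profile singular at the origin and its shell-centred images `λ_k u(λ_k² t, x_k + λ_k x)`
(`0 < λ_k ≤ ‖x_k‖ ≤ 2λ_k`) converge in `L³(Q(0,R))` (every `R > 0`) to the velocity `v` of a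
suitable weak slab solution, while the old origins `-x_k/λ_k` converge to `e`, then `v` is singular
at `(0, e)` (each image is singular at `-x_k/λ_k`; pick points of large norm nearby and apply
`stub_movingCentrePersistence`). -/
theorem parentSingular_of_imageLimit_of_tendsto {C : ℝ} {I : ℝ≥0∞} {u : ℝ → E³ → E³}
    {p : ℝ → E³ → ℝ} {G : ℝ → E³ → E³ →L[ℝ] E³} (hI : I < ⊤)
    (hsw : IsSuitableWeakSolutionOn (slab E³ (Iio 0) isOpen_Iio) 1 0 u p)
    (hwg : HasWeakSpatialGradientOn (slab E³ (Iio 0) isOpen_Iio) u G)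
    (hIle : typeIBound (Iio (0 : ℝ) ×ˢ univ) u p G ≤ I)
    (hC : HasTypeITimeDecay C u)
    (hcont : ContinuousOn (uncurry u) (Iio (0 : ℝ) ×ˢ univ))
    (hsing : IsBackwardSingularPoint u 0)
    {lk : ℕ → ℝ} {xk : ℕ → E³} (hlk : ∀ k, 0 < lk k)
    {v : ℝ → E³ → E³} {q : ℝ → E³ → ℝ}
    (hv : IsSuitableWeakSolutionOn (slab E³ (Iio 0) isOpen_Iio) 1 0 v q)
    (hconv : ∀ R : ℝ, 0 < R → Tendsto (fun k => eLpNorm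
      (uncurry (lk k • stPull (lk k ^ 2) (lk k) 0 (xk k) u) - uncurry v) 3
      (volume.restrict (parabolicCylinder R (0 : ℝ × E³)))) atTop (𝓝 0))
    {e : E³} (hye : Tendsto (fun k => -((lk k)⁻¹ • xk k)) atTop (𝓝 e)) :
    IsBackwardSingularPoint v ((0 : ℝ), e) := by
  set y : ℕ → E³ := fun k => -((lk k)⁻¹ • xk k) with hy
  -- each image is singular at `y k`: pick points of large norm nearby
  have hWsing : ∀ k, IsBackwardSingularPoint (lk k • stPull (lk k ^ 2) (lk k) 0 (xk k) u) ((0 : ℝ), y k) :=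
    fun k => isBackwardSingularPoint_image_preimageOrigin hsing (hlk k) (xk k)
  have hpts : ∀ k : ℕ, ∃ qq ∈ parabolicCylinder (1 / ((k : ℝ) + 1)) ((0 : ℝ), y k),
      (k : ℝ) < ‖(lk k • stPull (lk k ^ 2) (lk k) 0 (xk k) u) qq.1 qq.2‖ := fun k =>
    exists_mem_parabolicCylinder_lt_norm (hWsing k) (by positivity) k
  choose qq hqq hqval using hpts
  have hcd := fun k => image_classData hsw hwg hIle hC hcont (hlk k) (xk k)
  have hli : LocallyIntegrableOn (uncurry v) (Iio (0 : ℝ) ×ˢ (univ : Set E³)) volume := by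
    have := hv.distributional.1
    rwa [coe_slab] at this
  have ht_lt : ∀ k : ℕ, (qq k).1 < 0 := fun k => by
    have := hqq k
    rw [mem_parabolicCylinder] at this
    simpa using this.1.2
  have ht_gt : ∀ k : ℕ, -(1 / ((k : ℝ) + 1)) ^ 2 < (qq k).1 := fun k => by
    have := hqq k
    rw [mem_parabolicCylinder] at this
    simpa using this.1.1
  have hx_near : ∀ k : ℕ, dist (qq k).2 (y k) < 1 / ((k : ℝ) + 1) := fun k => by
    have := hqq k
    rw [mem_parabolicCylinder] at this
    exact this.2
  have hk1 : Tendsto (fun k : ℕ => 1 / ((k : ℝ) + 1)) atTop (𝓝 0) := tendsto_one_div_add_atTop_nhds_zero_nat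
  have htk0 : Tendsto (fun k => (qq k).1) atTop (𝓝 0) := by
    have hlow : Tendsto (fun k : ℕ => -(1 / ((k : ℝ) + 1)) ^ 2) atTop (𝓝 0) := by
      have : Tendsto (fun k : ℕ => -((1 / ((k : ℝ) + 1)) ^ 2)) atTop (𝓝 (-(0 ^ 2))) := (hk1.pow 2).neg
      simpa [neg_pow_two] using this
    exact tendsto_of_tendsto_of_tendsto_of_le_of_le hlow tendsto_const_nhds
      (fun k => (ht_gt k).le) (fun k => (ht_lt k).le)
  have hxk : Tendsto (fun k => (qq k).2) atTop (𝓝 e) := by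
    refine (tendsto_iff_dist_tendsto_zero).2 ?_
    have hd : ∀ k : ℕ, dist (qq k).2 e ≤ 1 / ((k : ℝ) + 1) + dist (y k) e := fun k =>
      (dist_triangle _ (y k) _).trans (add_le_add (hx_near k).le le_rfl)
    have h0 : Tendsto (fun k : ℕ => 1 / ((k : ℝ) + 1) + dist (y k) e) atTop (𝓝 0) := by
      have h2 : Tendsto (fun k => dist (y k) e) atTop (𝓝 0) := (tendsto_iff_dist_tendsto_zero).1 hye
      simpa using hk1.add h2
    exact squeeze_zero (fun k => dist_nonneg) hd h0
  have hblow : Tendsto (fun k => ‖(lk k • stPull (lk k ^ 2) (lk k) 0 (xk k) u) (qq k).1 (qq k).2‖)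
      atTop atTop :=
    tendsto_atTop_mono (fun k => (hqval k).le) tendsto_natCast_atTop_atTop
  exact stub_movingCentrePersistence I
    (fun k => lk k • stPull (lk k ^ 2) (lk k) 0 (xk k) u)
    (fun k => lk k ^ 2 • stPull (lk k ^ 2) (lk k) 0 (xk k) p)
    (fun k => lk k ^ 2 • stPull (lk k ^ 2) (lk k) 0 (xk k) G)
    v (fun k => (qq k).1) (fun k => (qq k).2) e hI
    (fun k => (hcd k).1) (fun k => (hcd k).2.1) (fun k => (hcd k).2.2.1) (fun k => (hcd k).2.2.2.2) hli
    hconv ht_lt htk0 hxk hblow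

/-! ### Tightness passes to the limit at the old origin -/

/-- `Q((0,e),r) ⊆ Q((0,y),r')` once `r + dist e y ≤ r'` (and `r ≤ r'`). -/
theorem parabolicCylinder_subset_of_dist_le {e y : E³} {r r' : ℝ} (hr : 0 ≤ r) (h : r + dist e y ≤ r') :
    parabolicCylinder r ((0 : ℝ), e) ⊆ parabolicCylinder r' ((0 : ℝ), y) := by
  intro w hw
  rw [mem_parabolicCylinder] at hw ⊢
  have hrr' : r ≤ r' := by linarith [dist_nonneg (x := e) (y := y)]
  have h2 : r ^ 2 ≤ r' ^ 2 := pow_le_pow_left₀ hr hrr' 2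
  refine ⟨⟨by simpa using (show (0 : ℝ) - r' ^ 2 < w.1 by linarith [hw.1.1]), by simpa using hw.1.2⟩, ?_⟩
  calc dist w.2 y ≤ dist w.2 e + dist e y := dist_triangle _ _ _
    _ < r + dist e y := by linarith [hw.2]
    _ ≤ r' := h

/-- The integral of `|G|²` over `Q(z,r)` is `r E(G; Q(z,r))` (`r > 0`). -/
theorem setLIntegral_frobenius_eq_mul_cknE {r : ℝ} (hr : 0 < r) (z : ℝ × E³)
    (G : ℝ → E³ → E³ →L[ℝ] E³) :
    ∫⁻ w in parabolicCylinder r z, ENNReal.ofReal (frobeniusNormSq (G w.1 w.2)) =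
      ENNReal.ofReal r * cknE r z G := by
  unfold cknE
  rw [← mul_assoc, ENNReal.mul_inv_cancel (by simpa using hr) ENNReal.ofReal_ne_top, one_mul]

/-- **Tightness passes to the limit at the old origin.** Let the shell-centred images of a
continuous class profile `(u,p,G)` converge in `L³(Q(0,R))` (every `R`) to a field `v` with a weak
spatial gradient `H` on the slab that is square integrable on every `Q((0,e₀),r)`, and let the old
origins `-x_k/λ_k` converge to `e₀`.  If `E(G; Q((0,0),ρ)) ≤ T < ⊤` for every `ρ > 0`, then
`E(H; Q((0,e₀),r)) ≤ T` for every `r > 0`: the image dissipation about `(0, -x_k/λ_k)` IS the parent's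
about the origin (`cknE_image_oldOrigin`), `Q((0,e₀),r) ⊆ Q((0,-x_k/λ_k),(1+ε)r)` eventually, and
`E` is lower semicontinuous under the convergence (`cknE_le_of_tendsto_eLpNorm`). -/
theorem cknE_limit_oldOrigin_le {C : ℝ} {I : ℝ≥0∞} {u : ℝ → E³ → E³}
    {p : ℝ → E³ → ℝ} {G : ℝ → E³ → E³ →L[ℝ] E³}
    (hsw : IsSuitableWeakSolutionOn (slab E³ (Iio 0) isOpen_Iio) 1 0 u p)
    (hwg : HasWeakSpatialGradientOn (slab E³ (Iio 0) isOpen_Iio) u G)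
    (hIle : typeIBound (Iio (0 : ℝ) ×ˢ univ) u p G ≤ I)
    (hC : HasTypeITimeDecay C u)
    (hcont : ContinuousOn (uncurry u) (Iio (0 : ℝ) ×ˢ univ))
    {lk : ℕ → ℝ} {xk : ℕ → E³} (hlk : ∀ k, 0 < lk k)
    {v : ℝ → E³ → E³} {H : ℝ → E³ → E³ →L[ℝ] E³}
    (hvg : HasWeakSpatialGradientOn (slab E³ (Iio 0) isOpen_Iio) v H)
    {e₀ : E³}
    (hfin : ∀ r : ℝ, 0 < r →
      ∫⁻ w in parabolicCylinder r ((0 : ℝ), e₀), ENNReal.ofReal (frobeniusNormSq (H w.1 w.2)) < ⊤)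
    (hconv : ∀ R : ℝ, 0 < R → Tendsto (fun k => eLpNorm
      (uncurry (lk k • stPull (lk k ^ 2) (lk k) 0 (xk k) u) - uncurry v) 3
      (volume.restrict (parabolicCylinder R (0 : ℝ × E³)))) atTop (𝓝 0))
    (hye : Tendsto (fun k => -((lk k)⁻¹ • xk k)) atTop (𝓝 e₀))
    {T : ℝ≥0∞} (hT : T < ⊤) (htight : ∀ ρ : ℝ, 0 < ρ → cknE ρ (0 : ℝ × E³) G ≤ T) :
    ∀ r : ℝ, 0 < r → cknE r ((0 : ℝ), e₀) H ≤ T := by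
  intro r hr
  set y : ℕ → E³ := fun k => -((lk k)⁻¹ • xk k) with hy
  set w : ℕ → ℝ → E³ → E³ := fun k => lk k • stPull (lk k ^ 2) (lk k) 0 (xk k) u with hw
  set Gw : ℕ → ℝ → E³ → E³ →L[ℝ] E³ := fun k => lk k ^ 2 • stPull (lk k ^ 2) (lk k) 0 (xk k) G
    with hGw
  have hcd := fun k => image_classData hsw hwg hIle hC hcont (hlk k) (xk k)
  -- it suffices to prove `E ≤ (1 + ε) T` for every `ε > 0`
  refine ENNReal.le_of_forall_pos_le_add fun ε hε _ => ?_
  -- choose `δ > 0` with `ofReal δ * T ≤ ε`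
  obtain ⟨δ, hδ, hδT⟩ : ∃ δ : ℝ, 0 < δ ∧ ENNReal.ofReal δ * T ≤ ε := by
    rcases eq_or_ne T 0 with hT0 | hT0
    · exact ⟨1, one_pos, by simp [hT0]⟩
    · refine ⟨(ε : ℝ) / 2 / T.toReal, by
        have : 0 < T.toReal := ENNReal.toReal_pos hT0 hT.ne
        positivity, ?_⟩
      rw [show ENNReal.ofReal ((ε : ℝ) / 2 / T.toReal) * T =
          ENNReal.ofReal ((ε : ℝ) / 2 / T.toReal) * ENNReal.ofReal T.toReal by
            rw [ENNReal.ofReal_toReal hT.ne],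
        ← ENNReal.ofReal_mul (by positivity), div_mul_cancel₀ _ (ENNReal.toReal_pos hT0 hT.ne).ne']
      have : ENNReal.ofReal ((ε : ℝ) / 2) ≤ (ε : ℝ≥0∞) := by
        rw [ENNReal.ofReal_div_of_pos two_pos, ENNReal.ofReal_coe_nnreal]
        exact ENNReal.half_le_self.trans_eq' (by simp [ENNReal.div_eq_inv_mul, mul_comm])
      exact this
  -- the enlarged radius `r' = (1 + δ) r`; eventually `Q((0,e₀),r) ⊆ Q((0,y_k),r')`
  set r' : ℝ := (1 + δ) * r with hr'
  have hr'0 : 0 < r' := by positivity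
  have hev : ∀ᶠ k in atTop, dist e₀ (y k) < δ * r := by
    have h := (tendsto_iff_dist_tendsto_zero.1 hye).eventually (gt_mem_nhds (mul_pos hδ hr))
    filter_upwards [h] with k hk
    rwa [dist_comm] at hk
  obtain ⟨j₀, hj₀⟩ := hev.exists_forall_of_atTop
  -- the uniform bound along the tail `k + j₀`
  have hbound : ∀ k, cknE r ((0 : ℝ), e₀) (Gw (k + j₀)) ≤ ENNReal.ofReal (1 + δ) * T := by
    intro k
    have hsub : parabolicCylinder r ((0 : ℝ), e₀) ⊆ parabolicCylinder r' ((0 : ℝ), y (k + j₀)) :=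
      parabolicCylinder_subset_of_dist_le hr.le (by
        rw [hr']; nlinarith [hj₀ (k + j₀) (Nat.le_add_left _ _), hr])
    have hmono : ∫⁻ w in parabolicCylinder r ((0 : ℝ), e₀), ENNReal.ofReal (frobeniusNormSq (Gw (k + j₀) w.1 w.2)) ≤
        ∫⁻ w in parabolicCylinder r' ((0 : ℝ), y (k + j₀)), ENNReal.ofReal (frobeniusNormSq (Gw (k + j₀) w.1 w.2)) :=
      lintegral_mono_set hsub
    rw [setLIntegral_frobenius_eq_mul_cknE hr'0, hGw, hy, cknE_image_oldOrigin (hlk _) (xk _) hr'0 G] at hmono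
    have hT' := htight (lk (k + j₀) * r') (mul_pos (hlk _) hr'0)
    unfold cknE
    calc (ENNReal.ofReal r)⁻¹ * ∫⁻ w in parabolicCylinder r ((0 : ℝ), e₀),
          ENNReal.ofReal (frobeniusNormSq ((lk (k + j₀) ^ 2 • stPull (lk (k + j₀) ^ 2) (lk (k + j₀)) 0
            (xk (k + j₀)) G) w.1 w.2))
        ≤ (ENNReal.ofReal r)⁻¹ * (ENNReal.ofReal r' * cknE (lk (k + j₀) * r') (0 : ℝ × E³) G) := by
          gcongr
      _ ≤ (ENNReal.ofReal r)⁻¹ * (ENNReal.ofReal r' * T) := by gcongr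
      _ = ENNReal.ofReal (1 + δ) * T := by
          have hrr : (ENNReal.ofReal r)⁻¹ * ENNReal.ofReal r = 1 :=
            ENNReal.inv_mul_cancel (by simpa using hr) ENNReal.ofReal_ne_top
          rw [hr', ENNReal.ofReal_mul (by positivity), ← mul_assoc, ← mul_assoc,
            mul_comm ((ENNReal.ofReal r)⁻¹), mul_assoc (ENNReal.ofReal (1 + δ)), hrr, mul_one]
  -- lower semicontinuity along the tail
  set R₀ : ℝ := r + ‖e₀‖ + 1 with hR₀
  have hR₀0 : 0 < R₀ := by rw [hR₀]; positivity
  have hQ : parabolicCylinder r ((0 : ℝ), e₀) ⊆ parabolicCylinder R₀ (0 : ℝ × E³) :=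
    parabolicCylinder_shift_subset hr.le (by rw [hR₀]; linarith)
  have hle0 : parabolicCylinderOpens r ((0 : ℝ), e₀) ≤ slab E³ (Iio 0) isOpen_Iio :=
    parabolicCylinderOpens_le_slab r le_rfl
  have hGk : ∀ k, HasWeakSpatialGradientOn (parabolicCylinderOpens r ((0 : ℝ), e₀)) (w (k + j₀)) (Gw (k + j₀)) :=
    fun k => (hcd (k + j₀)).2.1.mono hle0
  have hconv' : Tendsto (fun k => eLpNorm (uncurry (w (k + j₀)) - uncurry v) 3
      (volume.restrict (parabolicCylinder R₀ (0 : ℝ × E³)))) atTop (𝓝 0) :=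
    (hconv R₀ hR₀0).comp (tendsto_add_atTop_nat j₀)
  have key := cknE_le_of_tendsto_eLpNorm hr hQ hGk (hvg.mono hle0) (hfin r hr) hconv' hbound
  calc cknE r ((0 : ℝ), e₀) H ≤ ENNReal.ofReal (1 + δ) * T := key
    _ = T + ENNReal.ofReal δ * T := by
        rw [ENNReal.ofReal_add zero_le_one hδ.le, ENNReal.ofReal_one, add_mul, one_mul]
    _ ≤ T + ε := add_le_add le_rfl hδT

/-! ### The stub -/

/-- **S6, TIGHT PROFILES ARE APEX** (fed S4(b); `orbitDichotomy`: a non-apex continuous class profile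
has shell-centred images converging to an origin-singular class-`(C,4I)` profile `v`; `v` is also
singular at the limit position `e₀` of the old origin (`parentSingular_of_imageLimit_of_tendsto`),
and the TIGHTNESS of `u` about its origin passes to `v` about `(0,e₀)` (`cknE_limit_oldOrigin_le`);
translating `e₀` to the origin, S4(b) with the quanta at `0` and at `−e₀` contradicts tightness):
an origin-singular continuous class-`(C,I)` profile with `sup_{r>0} E(Q((0,0),r)) < (9/4) e`, `e` a
band quantum at every singular point of every continuous class-`(C,4I)` profile, has the apex bound
`HasTypeIDecay C'` for some `C'`. [cite: AlbrittonBarker2019, Lemma 2.2, Prop. 2.3 and §3] -/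
theorem stub_tightIsApex
    (hS4 : ∀ (G : ℝ → E³ → E³ →L[ℝ] E³) (e s : ℝ) (b : E³), 0 ≤ e → 0 < s → ‖b‖ = s →
      (∀ ρ : ℝ, 0 < ρ → ENNReal.ofReal (e * ρ) ≤
        ∫⁻ z in parabolicCylinder (ρ / 2) ((-(ρ ^ 2 / 4) : ℝ), (0 : E³)),
          ENNReal.ofReal (frobeniusNormSq (G z.1 z.2))) →
      (∀ ρ : ℝ, 0 < ρ → ENNReal.ofReal (e * ρ) ≤
        ∫⁻ z in parabolicCylinder (ρ / 2) ((-(ρ ^ 2 / 4) : ℝ), b),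
          ENNReal.ofReal (frobeniusNormSq (G z.1 z.2))) →
      ENNReal.ofReal (9 / 4 * e) ≤ cknE (2 * s) ((0 : ℝ), (0 : E³)) G) :
    ∀ (C : ℝ) (I : ℝ≥0∞) (e : ℝ), I < ⊤ → 0 < e →
      (∀ (v : ℝ → E³ → E³) (q : ℝ → E³ → ℝ) (H : ℝ → E³ → E³ →L[ℝ] E³),
        IsSuitableWeakSolutionOn (slab E³ (Iio 0) isOpen_Iio) 1 0 v q →
        HasWeakSpatialGradientOn (slab E³ (Iio 0) isOpen_Iio) v H →
        typeIBound (Iio (0 : ℝ) ×ˢ univ) v q H ≤ 4 * I →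
        HasTypeITimeDecay C v →
        ContinuousOn (uncurry v) (Iio (0 : ℝ) ×ˢ univ) →
        ∀ b : E³, IsBackwardSingularPoint v ((0 : ℝ), b) →
        ∀ ρ : ℝ, 0 < ρ → ENNReal.ofReal (e * ρ) ≤
          ∫⁻ z in parabolicCylinder (ρ / 2) ((-(ρ ^ 2 / 4) : ℝ), b),
            ENNReal.ofReal (frobeniusNormSq (H z.1 z.2))) →
      ∀ (u : ℝ → E³ → E³) (p : ℝ → E³ → ℝ) (G : ℝ → E³ → E³ →L[ℝ] E³),
        IsSuitableWeakSolutionOn (slab E³ (Iio 0) isOpen_Iio) 1 0 u p →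
        HasWeakSpatialGradientOn (slab E³ (Iio 0) isOpen_Iio) u G →
        typeIBound (Iio (0 : ℝ) ×ˢ univ) u p G ≤ I →
        HasTypeITimeDecay C u →
        ContinuousOn (uncurry u) (Iio (0 : ℝ) ×ˢ univ) →
        IsBackwardSingularPoint u 0 →
        (⨆ (r : ℝ) (_ : 0 < r), cknE r ((0 : ℝ), (0 : E³)) G) < ENNReal.ofReal (9 / 4 * e) →
        ∃ C' : ℝ, HasTypeIDecay C' u := by
  intro C I e hI he hq u p G hsw hwg hIle hC hcont hsing htight
  rcases orbitDichotomy hI hsw hwg hIle hC hcont with hapex |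
      ⟨lk, xk, v, q, H, hadm, hv, hvg, hvI, hvC, hvcont, hconv, hvsing⟩
  · exact hapex
  exfalso
  -- ## the tightness level `T`
  set T : ℝ≥0∞ := ⨆ (r : ℝ) (_ : 0 < r), cknE r ((0 : ℝ), (0 : E³)) G with hTdef
  have hTlt : T < ENNReal.ofReal (9 / 4 * e) := htight
  have hTtop : T < ⊤ := hTlt.trans ENNReal.ofReal_lt_top
  have htightρ : ∀ ρ : ℝ, 0 < ρ → cknE ρ (0 : ℝ × E³) G ≤ T := fun ρ hρ =>
    le_iSup₂ (f := fun (r : ℝ) (_ : 0 < r) => cknE r ((0 : ℝ), (0 : E³)) G) ρ hρ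
  -- ## a convergent subsequence of the old origins `y k = -x_k/λ_k`, `1 ≤ ‖y k‖ ≤ 2`
  set y : ℕ → E³ := fun k => -((lk k)⁻¹ • xk k) with hy
  have hynorm : ∀ k, ‖y k‖ = ‖xk k‖ / lk k := fun k => by
    rw [hy]
    simp only [norm_neg, norm_smul, norm_inv, Real.norm_of_nonneg (hadm k).1.le]
    rw [div_eq_inv_mul]
  have hy1 : ∀ k, 1 ≤ ‖y k‖ := fun k => by
    rw [hynorm, le_div_iff₀ (hadm k).1, one_mul]
    exact (hadm k).2.1
  have hy2 : ∀ k, ‖y k‖ ≤ 2 := fun k => by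
    rw [hynorm, div_le_iff₀ (hadm k).1]
    exact (hadm k).2.2
  obtain ⟨e₀, he₀, φ, hφ, hye⟩ : ∃ e₀ ∈ closedBall (0 : E³) 2, ∃ φ : ℕ → ℕ, StrictMono φ ∧
      Tendsto (y ∘ φ) atTop (𝓝 e₀) :=
    (isCompact_closedBall (0 : E³) 2).tendsto_subseq fun k => by
      rw [mem_closedBall, dist_zero_right]; exact hy2 k
  have he₀1 : 1 ≤ ‖e₀‖ := ge_of_tendsto hye.norm (Eventually.of_forall fun k => hy1 (φ k))
  have hs : 0 < ‖e₀‖ := lt_of_lt_of_le one_pos he₀1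
  -- ## data along `φ`
  have hlk' : ∀ k, 0 < lk (φ k) := fun k => (hadm (φ k)).1
  have hconv' : ∀ R : ℝ, 0 < R → Tendsto (fun k => eLpNorm
      (uncurry (lk (φ k) • stPull (lk (φ k) ^ 2) (lk (φ k)) 0 (xk (φ k)) u) - uncurry v) 3
      (volume.restrict (parabolicCylinder R (0 : ℝ × E³)))) atTop (𝓝 0) := fun R hR =>
    (hconv R hR).comp hφ.tendsto_atTop
  have hye' : Tendsto (fun k => -((lk (φ k))⁻¹ • xk (φ k))) atTop (𝓝 e₀) := hye
  -- ## the limit is singular at `(0, e₀)` (parent–child) and tight about it (lsc)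
  have hsingE : IsBackwardSingularPoint v ((0 : ℝ), e₀) :=
    parentSingular_of_imageLimit_of_tendsto hI hsw hwg hIle hC hcont hsing hlk' hv hconv' hye'
  have h4I : 4 * I < ⊤ := ENNReal.mul_lt_top (by simp) hI
  have hfin : ∀ r : ℝ, 0 < r →
      ∫⁻ w in parabolicCylinder r ((0 : ℝ), e₀), ENNReal.ofReal (frobeniusNormSq (H w.1 w.2)) < ⊤ := by
    intro r hr
    have h1 : cknE r ((0 : ℝ), e₀) H ≤ 4 * I :=
      (cknE_le_abScaledSum.trans (abScaledSum_le_typeIBound hr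
        (parabolicCylinder_subset_lowerHalf le_rfl r))).trans hvI
    rw [setLIntegral_frobenius_eq_mul_cknE hr]
    exact ENNReal.mul_lt_top ENNReal.ofReal_lt_top (lt_of_le_of_lt h1 h4I)
  have hTv : ∀ r : ℝ, 0 < r → cknE r ((0 : ℝ), e₀) H ≤ T :=
    cknE_limit_oldOrigin_le hsw hwg hIle hC hcont hlk' hvg hfin hconv' hye' hTtop htightρ
  -- ## translate `e₀` to the origin: two singular points with quanta, tight about the origin
  set w : ℝ → E³ → E³ := translate e₀ v with hw
  set qw : ℝ → E³ → ℝ := translate e₀ q with hqw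
  set Hw : ℝ → E³ → E³ →L[ℝ] E³ := translate e₀ H with hHw
  have hsw_w : IsSuitableWeakSolutionOn (slab E³ (Iio 0) isOpen_Iio) 1 0 w qw :=
    isSuitableWeakSolutionOn_translate hv e₀
  have hwg_w : HasWeakSpatialGradientOn (slab E³ (Iio 0) isOpen_Iio) w Hw :=
    hasWeakSpatialGradientOn_translate hvg e₀
  have hI_w : typeIBound (Iio (0 : ℝ) ×ˢ univ) w qw Hw ≤ 4 * I := by
    rw [hw, hqw, hHw, typeIBound_translate]
    exact hvI
  have hC_w : HasTypeITimeDecay C w := hasTypeITimeDecay_translate hvC e₀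
  have hcont_w : ContinuousOn (uncurry w) (Iio (0 : ℝ) ×ˢ univ) := by
    rw [hw, uncurry_translate]
    refine hvcont.comp (by fun_prop) fun z hz => ⟨hz.1, mem_univ _⟩
  have hsing_w0 : IsBackwardSingularPoint w 0 := (isBackwardSingularPoint_translate_iff e₀ v).2 hsingE
  have hsing_w1 : IsBackwardSingularPoint w ((0 : ℝ), -e₀) := by
    have hback : translate (-e₀) w = v := by
      funext t x
      show v t (e₀ + (-e₀ + x)) = v t x
      rw [← add_assoc, add_neg_cancel, zero_add]
    rw [← isBackwardSingularPoint_translate_iff (-e₀) w, hback]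
    exact hvsing
  have hq0 := hq w qw Hw hsw_w hwg_w hI_w hC_w hcont_w 0 hsing_w0
  have hq1 := hq w qw Hw hsw_w hwg_w hI_w hC_w hcont_w (-e₀) hsing_w1
  -- ## accounting: `(9/4) e ≤ E(w; Q(0, 2‖e₀‖)) = E(v; Q((0,e₀), 2‖e₀‖)) ≤ T < (9/4) e`
  have hacc : ENNReal.ofReal (9 / 4 * e) ≤ cknE (2 * ‖e₀‖) ((0 : ℝ), (0 : E³)) Hw :=
    hS4 Hw e ‖e₀‖ (-e₀) he.le hs (norm_neg e₀) hq0 hq1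
  have hE : cknE (2 * ‖e₀‖) ((0 : ℝ), (0 : E³)) Hw = cknE (2 * ‖e₀‖) ((0 : ℝ), e₀) H := by
    have h := cknE_nsZoom one_pos (by positivity : (0 : ℝ) < 2 * ‖e₀‖) 0 e₀ (0 : ℝ × E³) H
    rw [translate_G_eq, one_mul] at h
    have h0 : stAffine (1 ^ 2) 1 0 e₀ (0 : ℝ × E³) = ((0 : ℝ), e₀) := by
      simp [stAffine]
    rw [h0] at h
    rw [hHw]
    exact h
  have hle : ENNReal.ofReal (9 / 4 * e) ≤ T :=
    hacc.trans (hE.le.trans (hTv (2 * ‖e₀‖) (by positivity)))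
  exact absurd hTlt (not_lt.2 hle)

end Summit.NavierStokesRegularity.NavierStokesRegularity.Theorems.RellichScarApexLocalisation
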